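import Summits.HodgeConjecture.HodgeConjecture.Theorems.Ring2AbelianAllAndreIsogenousPencilsNodes
import Summits.HodgeConjecture.HodgeConjecture.Theorems.Ring2AbelianAllAndreWeightGysinSupport
import Literature.AlgebraicGeometry.Morphisms.FiniteOfClosedFibres
import Literature.NumberTheory.Transcendental.AnalytificationConnected
import HarnessLib

/-!
# Ring 2 · sub-cell AbelianAll (ALL ABELIAN VARIETIES), André axis, part XXXV-a — A FIBREWISE ISOGENY OF COMPACT ABELIAN
# PENCILS IS A FINITE MORPHISM: a surjective `S`-morphism `ψ : 𝒳 ⟶ 𝒳'` of compact pencils of abelian varieties of the same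
# relative dimension `d` has `ψ.left` FINITE (hence locally quasi-finite), so the instance hypothesis `[LocallyQuasiFinite ψ.left]`
# of parts XXXIV-a / XXXIV-c / XXXIV-d is DISCHARGED — the lift, its every-point and CM-pointed forms, the number of lifted
# classes `r_p` and the lift defect `δ_p` are invariants of the `S`-isogeny class of the pencil with NOTHING asked of `ψ` but
# surjectivity. FACT-FREE

HONEST FRAMING (page 1, verbatim): **research route, not a corollary; conditional on HC_CM plus one named
minimal statement.** Cell line: research route conditional on HC_CM; not a corollary; Q11.4-sentence-2 already
refuted in dim ≥ 3. Nothing in this file proves a case of the Hodge conjecture for an abelian variety; `HC_CM`, `HC_AV`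
do not occur; no node is born (0 `def`), no named fact is used, no `sorry`; axioms standard; nothing is claimed minimal.

## What this part does (the owed item (o102) of the seat's hand-over: «drop `[LocallyQuasiFinite ψ.left]`»)

Part XXXIV-a proved the ASCENT of the lift `(L)_t(p)` along a surjective `S`-morphism `ψ` of compact abelian pencils of the same
relative dimension under the instance hypothesis `[LocallyQuasiFinite ψ.left]` (used once: `ψ^*` must preserve algebraic classes
on the TOTAL spaces, the tree's `map_mem_algebraicClasses_of_locallyQuasiFinite`), and parts XXXIV-c/d inherited it in the
CM-pointed shares and in the equalities `r_p(ψ ≫ f') = r_p(f')`, `δ_p(ψ ≫ f') = δ_p(f')`; the hand-over recorded it as «honest: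
isogenies are finite, not derived». This file DERIVES it:

* §1 `isFinite_left_of_abelianVariety_charts` — a SURJECTIVE morphism `g : X ⟶ X'` between complex varieties carrying charts
  `A.X ≅ X`, `A'.X ≅ X'` of abelian varieties of the SAME dimension is FINITE: through the charts and after the translation by
  `−g(0)` it is a surjective homomorphism (rigidity, the tree's `homOfOneComp`, as in part XXXIV-b), hence an isogeny
  (`isIsogeny_of_surjective_of_dim_eq`: surjective with finite kernel ⟹ finite), and finiteness is insensitive to the
  isomorphisms (`MorphismProperty.cancel_left/right_of_respectsIso`). For pencils: `isFinite_fiberOverMap_left` — every fibre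
  map `ψ_t : 𝒳_t ⟶ 𝒳'_t` is finite.
* §2 **`isFinite_left_of_isogenous`** — `ψ.left` ITSELF is finite: it is proper (`𝒳` proper, `𝒳'` separated), the base `𝒳'` is
  Jacobson (of finite type over `ℂ`), and its fibre over every CLOSED point `y` of `𝒳'` is finite — `y` is a complex point
  (Nullstellensatz, `ComplexPoints.equivClosedPoints`) lying on the fibre `𝒳'_t`, `t = f'(y)` (`range_fiberι_base_eq_preimage`),
  and the square `𝒳_t = 𝒳 ×_{𝒳'} 𝒳'_t` of part XXXIII-e (`isPullback_fiberι_fiberOverMap`) moves `ψ⁻¹(y)` into the finite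
  fibre `ψ_t⁻¹(y)` (`Scheme.exists_preimage_of_isPullback`, `Scheme.Hom.finite_preimage_singleton`); a proper morphism with
  finite fibres over the closed points of a Jacobson scheme is finite (Zariski's Main Theorem in the form of the tree's
  `isFinite_of_isProper_of_finite_preimage_closedPoint`, de Jong 1996 proof of 4.13 / Stacks 02UP). Corollaries:
  `locallyQuasiFinite_left_of_isogenous`; `isFinite_left_of_comp_eq` — a surjective `S`-ENDOMORPHISM `ν` of a compact abelian
  pencil (`ν ≫ f = f`; e.g. the `θ_N` of the weight package of parts XXIV–XXVIII) is finite.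
* §3 THE ROWS, HYPOTHESIS-FREE (surjectivity of `ψ` only): `map_mem_algebraicClasses_of_isogenous` (`ψ^*` preserves algebraic
  classes on the total spaces), **`comap_le_sup_comp_of_surjective`** (the lift ascends), **`comap_le_sup_iff_of_surjective`**
  (the lift is an isogeny invariant), `forall_comap_le_sup_iff_of_surjective` (every-point form), `forall_cm_comap_le_sup_iff_of_surjective`
  (the share of `(L)`), **`shares_iff_of_surjective`** (the shares of `(L)`, `(4)`, `(3)` at once); the rank rows `r_p`, `δ_p` of
  part XXXIV-d are restated hypothesis-free in the companion file `Ring2AbelianAllAndreIsogenousPencilsFiniteRank` (part XXXV-b).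

What is NOT claimed: flatness of `ψ` or anything about its degree / kernel group scheme; that `ψ_t` is a homomorphism for the
charts' group laws (only after a translation); local quasi-finiteness of a surjective `S`-morphism between smooth projective
families with NON-abelian fibres (false in general: fibrewise birational contractions); anything minimal; any case of HC; any
node-level statement (the nodes quantify over all pencils and gain nothing). EDGE LABELS: every row K (kernel, fact-free).

References: MumfordAV1970 (§4 Cor. 1 rigidity; §7 Application 3 p. 63 and §19 Thm. 1: isogenies are finite surjective);
Milne1986AbelianVarieties (§2 Cor. 2.2, §8 Prop. 8.1); GortzWedhorn2020 (Cor. 12.89: proper + quasi-finite = finite; Prop. 12.58);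
DeJong1996 (proof of Lemma 4.13, p. 70); StacksProject (Tags 02UP, 01TB, 02LS); Hartshorne1977 (II §3 fibres, II Ex. 3.5, Ex. 4.1);
Fulton1998 (§1.7, §19.2 Cor. 19.2 (b): pull-back of cycles along finite flat / l.c.i. morphisms); GrothendieckTopology1969 (§1);
Andre1996Motifs (§6.3, proof of Lemme 6.3.1, p. 32: «bouger s ou t par G(ℚ) change X_s, X_t en des variétés abéliennes
isogènes»); DeligneHodgeII1971 (proof of Lemme 4.4.16, p. 53: «remplaçant X par un schéma abélien isogène»);
Milne2020HodgeClassesAV (Prop. 1 p. 7). [Locators revised after REFEREE-AB F-ab-138 / F-ab-142: §5.1 p. 25 of Andre1996Motifs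
concerns replacing the BASE `S` by a finite étale cover, not the abelian scheme by an isogenous one.]
-/

noncomputable section

set_option linter.dupNamespace false

namespace Summit.HodgeConjecture.HodgeConjecture.Ring2.AbelianAll

open CategoryTheory CategoryTheory.Limits AlgebraicGeometry MonoidalCategory CartesianMonoidalCategory
open Literature.AlgebraicGeometry Literature.AlgebraicGeometry.Motives
open Literature.AlgebraicGeometry.HodgeTheory
open Literature.AlgebraicGeometry.Deligne1982 (cmLocus)

/-! ## §1 Surjective morphisms between varieties underlying abelian varieties of the same dimension are finite -/

section Charts

variable {X X' : SchemeOver ℂ} {A A' : AbelianVariety ℂ}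

/-- **A surjective morphism of the underlying varieties of two complex abelian varieties of the same dimension is FINITE**:
`t_{−g(0)} ∘ g` is a surjective homomorphism (rigidity, `homOfOneComp`), hence an isogeny (`isIsogeny_of_surjective_of_dim_eq`),
hence finite; translations are automorphisms. [cite: MumfordAV1970, §4 Cor. 1 and §19 Thm. 1] [cite: Milne1986AbelianVarieties, §2 Cor. 2.2 and §8 Prop. 8.1] -/
theorem isFinite_left_of_abelianVariety (g : A.X ⟶ A'.X) [Surjective g.left] (hdim : A.dim = A'.dim) : IsFinite g.left := by
  set h : A ⟶ A' := AbelianVariety.homOfOneComp (g ≫ A'.translation (AbelianVariety.originImage g)⁻¹)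
    (AbelianVariety.one_comp_comp_translation_inv g) with hh
  haveI : Surjective (AbelianVariety.Hom.toSchemeHom h) := by
    change Surjective (g ≫ A'.translation (AbelianVariety.originImage g)⁻¹).left
    rw [Over.comp_left]
    infer_instance
  have hfin : IsFinite (AbelianVariety.Hom.toSchemeHom h) := (AbelianVariety.isIsogeny_of_surjective_of_dim_eq h hdim).2
  change IsFinite (g ≫ A'.translation (AbelianVariety.originImage g)⁻¹).left at hfin
  rw [Over.comp_left] at hfin
  exact (MorphismProperty.cancel_right_of_respectsIso @IsFinite g.left _).1 hfin

/-- **Through charts**: a surjective morphism `g : X ⟶ X'` of complex varieties carrying charts `e : A.X ≅ X`, `e' : A'.X ≅ X'` of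
abelian varieties of the same dimension is finite (`e ≫ g ≫ e'⁻¹` is, and finiteness respects isomorphisms).
[cite: MumfordAV1970, §19 Thm. 1] [cite: GortzWedhorn2020, Prop. 12.58] -/
theorem isFinite_left_of_abelianVariety_charts (e : A.X ≅ X) (e' : A'.X ≅ X') (g : X ⟶ X') [Surjective g.left]
    (hdim : A.dim = A'.dim) : IsFinite g.left := by
  haveI : IsIso e.hom.left := ((Over.forget _).mapIso e).isIso_hom
  haveI : IsIso e'.inv.left := ((Over.forget _).mapIso e'.symm).isIso_hom
  haveI : Surjective (e.hom ≫ g ≫ e'.inv).left := by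
    rw [Over.comp_left, Over.comp_left]
    infer_instance
  have h := isFinite_left_of_abelianVariety (e.hom ≫ g ≫ e'.inv) hdim
  rw [Over.comp_left, Over.comp_left, MorphismProperty.cancel_left_of_respectsIso @IsFinite,
    MorphismProperty.cancel_right_of_respectsIso @IsFinite] at h
  exact h

end Charts

/-! ## §2 A surjective `S`-morphism of compact abelian pencils of the same relative dimension is finite -/

section Pencils

variable {𝒳 𝒳' S : SchemeOver ℂ} {d : ℕ} {f' : 𝒳' ⟶ S} {ψ : 𝒳 ⟶ 𝒳'}
  (hf : IsCompactAbelianPencil (ψ ≫ f') d) (hf' : IsCompactAbelianPencil f' d)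

variable [Surjective ψ.left]

include hf hf' in
/-- **Every fibre map `ψ_t : 𝒳_t ⟶ 𝒳'_t` of a surjective `S`-morphism of compact abelian pencils of the same relative dimension is
FINITE** (surjective by part XXXIII-e, between varieties underlying abelian `d`-folds by the pencils' charts; §1).
[cite: MumfordAV1970, §19 Thm. 1] [cite: Andre1996Motifs, §6.3 proof of Lemme 6.3.1 (p. 32)] -/
theorem isFinite_fiberOverMap_left (t : ComplexPoints S) : IsFinite (fiberOverMap ψ f' t).left := by
  obtain ⟨A, ⟨e⟩⟩ := hf.exists_abelianVariety_fiber t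
  obtain ⟨A', ⟨e'⟩⟩ := hf'.exists_abelianVariety_fiber t
  haveI := surjective_fiberOverMap_left f' ψ t
  exact isFinite_left_of_abelianVariety_charts e e' (fiberOverMap ψ f' t)
    ((Andre1996.compactPencil_dim_eq_of_iso hf e).trans (Andre1996.compactPencil_dim_eq_of_iso hf' e').symm)

include hf hf' in
/-- **A FIBREWISE ISOGENY OF COMPACT ABELIAN PENCILS IS A FINITE MORPHISM**: for a surjective `S`-morphism `ψ : 𝒳 ⟶ 𝒳'` of
compact pencils of abelian varieties of the same relative dimension, `ψ` is finite. It is proper (`𝒳` proper, `𝒳'` separated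
over `ℂ`); `𝒳'` is Jacobson; over a CLOSED point `y` of `𝒳'` — a complex point on some fibre `𝒳'_t` — the cartesian square
`𝒳_t = 𝒳 ×_{𝒳'} 𝒳'_t` moves `ψ⁻¹(y)` into the finite fibre `ψ_t⁻¹(y)` of the finite `ψ_t`; and a proper morphism with finite
fibres over the closed points of a Jacobson scheme is finite (Zariski's Main Theorem). FACT-FREE.
[cite: GortzWedhorn2020, Cor. 12.89] [cite: DeJong1996, Lemma 4.13 (proof), p. 70] [cite: StacksProject, Tag 02UP]
[cite: MumfordAV1970, §19 Thm. 1] -/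
theorem isFinite_left_of_isogenous : IsFinite ψ.left := by
  haveI : IsProper 𝒳.hom := IsSmoothProjective.isProper_holds hf.isSmoothProjective_total
  haveI : IsProper 𝒳'.hom := IsSmoothProjective.isProper_holds hf'.isSmoothProjective_total
  haveI : IsProper ψ.left := by
    have hc : IsProper (ψ.left ≫ 𝒳'.hom) := by rw [Over.w ψ]; infer_instance
    exact IsProper.of_comp ψ.left 𝒳'.hom
  haveI : JacobsonSpace 𝒳'.left := ComplexPoints.jacobsonSpace_left
  refine Literature.AlgebraicGeometry.Morphisms.isFinite_of_isProper_of_finite_preimage_closedPoint ψ.left fun y hy ↦ ?_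
  -- `y` is a complex point `x'` of `𝒳'`, on the fibre over `t = f'(x')`
  set x' : ComplexPoints 𝒳' := (ComplexPoints.equivClosedPoints 𝒳').symm ⟨y, hy⟩ with hx'
  have hx'y : x'.pt = y := by rw [hx', ComplexPoints.pt_equivClosedPoints_symm_apply]
  set t : ComplexPoints S := AlgPoints.map f' x' with ht
  have hyt : y ∈ Set.range (fiberι f' t).left.base := by
    rw [range_fiberι_base_eq_preimage f' t, Set.mem_preimage, Set.mem_singleton_iff, ht, AlgPoints.pt_map, hx'y]
  obtain ⟨q, hq⟩ := hyt
  -- the fibre map `ψ_t` is finite, so `ψ_t⁻¹(q)` is finite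
  haveI := isFinite_fiberOverMap_left hf hf' t
  have hfin : ((fiberOverMap ψ f' t).left.base ⁻¹' {q}).Finite := (fiberOverMap ψ f' t).left.finite_preimage_singleton q
  -- `ψ⁻¹(y) ⊆ j_t(ψ_t⁻¹(q))` by the cartesian square `𝒳_t = 𝒳 ×_{𝒳'} 𝒳'_t`
  refine (hfin.image (fiberι (ψ ≫ f') t).left.base).subset fun x hx ↦ ?_
  rw [Set.mem_preimage, Set.mem_singleton_iff] at hx
  obtain ⟨p, hp₁, hp₂⟩ := Scheme.exists_preimage_of_isPullback ((isPullback_fiberι_fiberOverMap f' ψ t).map (Over.forget _))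
    x q (show ψ.left.base x = (fiberι f' t).left.base q by rw [hx, hq])
  exact ⟨p, by rw [Set.mem_preimage, Set.mem_singleton_iff]; exact hp₂, hp₁⟩

include hf hf' in
/-- Hence `ψ` is locally quasi-finite — the instance hypothesis of parts XXXIV-a/c/d, now DERIVED. FACT-FREE.
[cite: GortzWedhorn2020, Cor. 12.89] [cite: StacksProject, Tag 02UP] -/
theorem locallyQuasiFinite_left_of_isogenous : LocallyQuasiFinite ψ.left := by
  haveI := isFinite_left_of_isogenous hf hf'
  infer_instance

omit [Surjective ψ.left] in
/-- **A surjective `S`-endomorphism of a compact abelian pencil is finite** (`ν ≫ f = f`, e.g. the fibrewise multiplication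
`θ_N` of the weight package of parts XXIV–XXVIII, whose local quasi-finiteness was displayed there as a hypothesis).
[cite: MumfordAV1970, §19 Thm. 1] [cite: GortzWedhorn2020, Cor. 12.89] -/
theorem isFinite_left_of_comp_eq {f : 𝒳 ⟶ S} (hf₀ : IsCompactAbelianPencil f d) (ν : 𝒳 ⟶ 𝒳) [Surjective ν.left]
    (hν : ν ≫ f = f) : IsFinite ν.left :=
  isFinite_left_of_isogenous (f' := f) (ψ := ν) (by rw [hν]; exact hf₀) hf₀

/-! ## §3 The rows of parts XXXIV-a/c/d, hypothesis-free -/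

include hf hf' in
/-- `ψ^*` preserves algebraic classes on the TOTAL spaces (the hypothesis `hpullTot` of part XXXIV-a, discharged: `ψ` is finite,
hence locally quasi-finite, and the tree's `map_mem_algebraicClasses_of_locallyQuasiFinite` applies). [cite: Fulton1998, §19.2 Cor. 19.2 (b) and §1.7]
[cite: GrothendieckTopology1969, §1] -/
theorem map_mem_algebraicClasses_of_isogenous {p : ℕ} {η' : complexBetti 𝒳' (2 * p)} (hη' : η' ∈ algebraicClasses 𝒳' p) :
    complexBetti.map ψ (2 * p) η' ∈ algebraicClasses 𝒳 p := by
  haveI := locallyQuasiFinite_left_of_isogenous hf hf'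
  exact map_mem_algebraicClasses_of_locallyQuasiFinite hf.isSmoothProjective_total hf'.isSmoothProjective_total ψ hη'

include hf hf' in
/-- **THE LIFT ASCENDS ALONG SURJECTIVE `S`-MORPHISMS OF COMPACT ABELIAN PENCILS of the same relative dimension** — part XXXIV-a's
`comap_le_sup_comp_of_isogenous` WITHOUT `[LocallyQuasiFinite ψ.left]`: `(L)_t(p)` for `f'` gives `(L)_t(p)` for `ψ ≫ f'`.
FACT-FREE. [cite: Milne2020HodgeClassesAV, Prop. 1 (p. 7)] [cite: Andre1996Motifs, §6.3 proof of Lemme 6.3.1 (p. 32)] -/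
theorem comap_le_sup_comp_of_surjective {t : ComplexPoints S} {p : ℕ}
    (h : (algebraicClasses (fiberOver f' t) p).comap (complexBetti.map (fiberι f' t) (2 * p)).hom ≤
      algebraicClasses 𝒳' p ⊔ LinearMap.ker (complexBetti.map (fiberι f' t) (2 * p)).hom) :
    (algebraicClasses (fiberOver (ψ ≫ f') t) p).comap (complexBetti.map (fiberι (ψ ≫ f') t) (2 * p)).hom ≤
      algebraicClasses 𝒳 p ⊔ LinearMap.ker (complexBetti.map (fiberι (ψ ≫ f') t) (2 * p)).hom := by
  haveI := locallyQuasiFinite_left_of_isogenous hf hf'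
  exact comap_le_sup_comp_of_isogenous hf hf' h

include hf hf' in
/-- **THE LIFT IS AN ISOGENY INVARIANT OF THE PENCIL, with nothing asked of `ψ` but surjectivity**: `(L)_t(p)` holds for
`ψ ≫ f'` iff it holds for `f'`. FACT-FREE. [cite: Milne2020HodgeClassesAV, Prop. 1 (p. 7)] [cite: Andre1996Motifs, §6.3 proof of Lemme 6.3.1 (p. 32)] -/
theorem comap_le_sup_iff_of_surjective (t : ComplexPoints S) (p : ℕ) :
    (algebraicClasses (fiberOver (ψ ≫ f') t) p).comap (complexBetti.map (fiberι (ψ ≫ f') t) (2 * p)).hom ≤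
        algebraicClasses 𝒳 p ⊔ LinearMap.ker (complexBetti.map (fiberι (ψ ≫ f') t) (2 * p)).hom ↔
      (algebraicClasses (fiberOver f' t) p).comap (complexBetti.map (fiberι f' t) (2 * p)).hom ≤
        algebraicClasses 𝒳' p ⊔ LinearMap.ker (complexBetti.map (fiberι f' t) (2 * p)).hom := by
  haveI := locallyQuasiFinite_left_of_isogenous hf hf'
  exact comap_le_sup_iff_of_isogenous hf hf' t p

include hf hf' in
/-- **The every-point lift (the pencil's share of `AlgebraicFixedPart`) is an isogeny invariant**, hypothesis-free. FACT-FREE.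
[cite: Milne2020HodgeClassesAV, Prop. 1 (p. 7)] -/
theorem forall_comap_le_sup_iff_of_surjective (p : ℕ) :
    (∀ t : ComplexPoints S, (algebraicClasses (fiberOver (ψ ≫ f') t) p).comap (complexBetti.map (fiberι (ψ ≫ f') t) (2 * p)).hom ≤
        algebraicClasses 𝒳 p ⊔ LinearMap.ker (complexBetti.map (fiberι (ψ ≫ f') t) (2 * p)).hom) ↔
      ∀ t : ComplexPoints S, (algebraicClasses (fiberOver f' t) p).comap (complexBetti.map (fiberι f' t) (2 * p)).hom ≤
        algebraicClasses 𝒳' p ⊔ LinearMap.ker (complexBetti.map (fiberι f' t) (2 * p)).hom := by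
  haveI := locallyQuasiFinite_left_of_isogenous hf hf'
  exact forall_comap_le_sup_iff_of_isogenous hf hf' p

include hf hf' in
/-- **The pencil's share of `(L) CMFibreAlgebraicLift` is an isogeny invariant**, hypothesis-free: the lift at every CM point
holds for `ψ ≫ f'` iff for `f'` (same CM locus, part XXXIV-b). FACT-FREE. [cite: Milne2020HodgeClassesAV, Prop. 1 (p. 7)]
[cite: Andre1996Motifs, §6.3 proof of Lemme 6.3.1 (p. 32)] -/
theorem forall_cm_comap_le_sup_iff_of_surjective (p : ℕ) :
    (∀ t ∈ cmLocus (ψ ≫ f') d, (algebraicClasses (fiberOver (ψ ≫ f') t) p).comap (complexBetti.map (fiberι (ψ ≫ f') t) (2 * p)).hom ≤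
        algebraicClasses 𝒳 p ⊔ LinearMap.ker (complexBetti.map (fiberι (ψ ≫ f') t) (2 * p)).hom) ↔
      ∀ t ∈ cmLocus f' d, (algebraicClasses (fiberOver f' t) p).comap (complexBetti.map (fiberι f' t) (2 * p)).hom ≤
        algebraicClasses 𝒳' p ⊔ LinearMap.ker (complexBetti.map (fiberι f' t) (2 * p)).hom := by
  haveI := locallyQuasiFinite_left_of_isogenous hf hf'
  exact forall_cm_comap_le_sup_iff_of_isogenous hf hf' p

include hf hf' in
/-- **ISOGENOUS PENCILS CARRY THE SAME ANDRÉ-AXIS CONTENT, with nothing asked of `ψ` but surjectivity** — the shares of `(L)`,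
`(4)` and `(3)` in all degrees at once hold for `ψ ≫ f'` iff they hold for `f'` (part XXXIV-c's `shares_iff_of_isogenous`
without `[LocallyQuasiFinite ψ.left]`). FACT-FREE. [cite: Andre1996Motifs, §6.3 proof of Lemme 6.3.1 (p. 32)] [cite: Milne2020HodgeClassesAV, Prop. 1 (p. 7)] -/
theorem shares_iff_of_surjective :
    ((∀ p, ∀ t ∈ cmLocus (ψ ≫ f') d,
        (algebraicClasses (fiberOver (ψ ≫ f') t) p).comap (complexBetti.map (fiberι (ψ ≫ f') t) (2 * p)).hom ≤
          algebraicClasses 𝒳 p ⊔ LinearMap.ker (complexBetti.map (fiberι (ψ ≫ f') t) (2 * p)).hom) ∧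
      (∀ p, ∀ t ∈ cmLocus (ψ ≫ f') d, ∀ s : ComplexPoints S,
        (algebraicClasses (fiberOver (ψ ≫ f') t) p).comap (complexBetti.map (fiberι (ψ ≫ f') t) (2 * p)).hom ≤
          (algebraicClasses (fiberOver (ψ ≫ f') s) p).comap (complexBetti.map (fiberι (ψ ≫ f') s) (2 * p)).hom) ∧
      (∀ p, (cmLocus (ψ ≫ f') d).Nonempty → ∀ t s : ComplexPoints S,
        (algebraicClasses (fiberOver (ψ ≫ f') t) p).comap (complexBetti.map (fiberι (ψ ≫ f') t) (2 * p)).hom ≤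
          (algebraicClasses (fiberOver (ψ ≫ f') s) p).comap (complexBetti.map (fiberι (ψ ≫ f') s) (2 * p)).hom)) ↔
    ((∀ p, ∀ t ∈ cmLocus f' d,
        (algebraicClasses (fiberOver f' t) p).comap (complexBetti.map (fiberι f' t) (2 * p)).hom ≤
          algebraicClasses 𝒳' p ⊔ LinearMap.ker (complexBetti.map (fiberι f' t) (2 * p)).hom) ∧
      (∀ p, ∀ t ∈ cmLocus f' d, ∀ s : ComplexPoints S,
        (algebraicClasses (fiberOver f' t) p).comap (complexBetti.map (fiberι f' t) (2 * p)).hom ≤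
          (algebraicClasses (fiberOver f' s) p).comap (complexBetti.map (fiberι f' s) (2 * p)).hom) ∧
      (∀ p, (cmLocus f' d).Nonempty → ∀ t s : ComplexPoints S,
        (algebraicClasses (fiberOver f' t) p).comap (complexBetti.map (fiberι f' t) (2 * p)).hom ≤
          (algebraicClasses (fiberOver f' s) p).comap (complexBetti.map (fiberι f' s) (2 * p)).hom)) := by
  haveI := locallyQuasiFinite_left_of_isogenous hf hf'
  exact shares_iff_of_isogenous hf hf'

end Pencils

end Summit.HodgeConjecture.HodgeConjecture.Ring2.AbelianAll

end
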